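import Literature.NumberTheory.GaloisRepresentations.GlobalPFiniteness
import Literature.NumberTheory.GaloisRepresentations.ArtinReciprocityCharacterFiniteProofs
import Literature.NumberTheory.NumberFields.HermiteFiniteness
import Mathlib.Data.SetLike.Fintype
import HarnessLib

/-!
# Mazur's `p`-finiteness condition `Φ_p` holds for `G_{K,S}` (proof of the named fact)

Topic `NumberTheory/GaloisRepresentations`; namespace
`Literature.NumberTheory.GaloisRepresentations`.  Proof file of `GlobalPFiniteness.lean`: theorems
only, no definitions, no named facts; it DISCHARGES the named fact
`galoisGroupUnramifiedOutside_phiP` (`galoisGroupUnramifiedOutside_phiP_holds`).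

Let `K` be a number field, `S` a FINITE set of finite places, `Γ_K = Gal(K̄/K)`, `N_S ≤ Γ_K` the
ramification subgroup outside `S` and `G_{K,S} = Γ_K ⧸ N_S` (`RestrictedRamification.lean`).
Mazur's standing example [cite: Mazur1989Deforming, §1.2] ("`G_{K,S}` satisfies `Φ_p`";
Chenevier's condition (F), [cite: Chenevier2014, §3.1 (Example: condition (F) for G_{K,S})]) is
proved here by HERMITE'S THEOREM rather than by class field theory, in four steps:

1. `isUnramifiedIn_of_ramificationSubgroup_le_fixingSubgroup` — **the bridge**: if `L ⊆ K̄` is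
   finite Galois over `K` with `N_S ≤ Gal(K̄/L)`, then every `v ∉ S` is unramified in `𝓞 L` (were
   `v` ramified, some absolute inertia element `g ∈ I_𝔓`, `𝔓 ∣ v`, would restrict non-trivially
   to `G(L|K)` — the tree's `exists_mem_inertia_absRestrictNormalHom_ne_one`, i.e. Serre, *Local
   Fields* I §7 Prop. 22 (b) with `#I = e` — but `g ∈ N_S ≤ Gal(K̄/L)` restricts to `1`);
2. `finite_setOf_isOpen_normal_ramificationSubgroup_le` — the open NORMAL subgroups `N ≥ N_S` of
   `Γ_K` of index `≤ n` are finitely many: `N ↦ K̄^N` is injective (Krull) into the number fields in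
   `K̄` of degree `≤ n` unramified outside `S`, a finite set by Hermite's theorem
   (`Literature.NumberTheory.NumberFields.finite_of_finrank_le_of_isUnramifiedAt`, Bombieri–Gubler
   Cor. B.2.15);
3. `finite_setOf_isOpen_ramificationSubgroup_le`,
   `finite_setOf_isOpen_index_le_galoisGroupUnramifiedOutside` — hence so are the open subgroups
   `U ≥ N_S` of index `≤ n` (each contains its normal core, open normal of index `∣ n!`, and a
   subgroup of finite index has finitely many oversubgroups), and the open subgroups of `G_{K,S}`
   of index `≤ n` (pull back along `Γ_K ↠ G_{K,S}`);
4. `mazurPhiP_of_finite_setOf_isOpen_index_le` — **pure topological group theory**: in a compact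
   group in which the open subgroups of each bounded index are finitely many, every open subgroup
   `H` has finitely many continuous (= locally constant) homomorphisms `f : H → ℤ/p`: the kernel
   of such an `f` is an open subgroup of index `≤ [G:H]·p`, so `f` kills the intersection `N₀` of
   the finitely many open subgroups of that index, an open subgroup, and `f ↦ (q ↦ f(q.out))`
   injects our set into the finite type of functions `G ⧸ N₀ → ℤ/p`.

Assembling: `galoisGroupUnramifiedOutside_phiP_holds`.

## References

* B. Mazur, *Deforming Galois representations*, in Galois groups over `ℚ`, MSRI Publ. 16 (1989),
  §1.1 (condition `Φ_p`), §1.2 (the example `G_{K,S}`). [cite: Mazur1989Deforming, §1.2]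
* G. Chenevier, *The p-adic analytic space of pseudocharacters of a profinite group and
  pseudorepresentations over arbitrary rings* (2014), §3.1, condition (F) and its Example.
  [cite: Chenevier2014, §3.1 (Example: condition (F) for G_{K,S})]
* J.-P. Serre, *Local Fields*, GTM 67 (1979), Ch. I §7 Prop. 22 (b).
  [cite: SerreLocalFields1979, Ch. I §7 Prop. 22(b)]
* E. Bombieri, W. Gubler, *Heights in Diophantine Geometry* (2006), Cor. B.2.15 (Hermite).

## Mathlib / tree reuse

`Subgroup.quotient_finite_of_isOpen`, `Subgroup.isOpen_of_isClosed_of_finiteIndex`,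
`Subgroup.normalCore_isClosed`, `Subgroup.normalCore_eq_ker`, `Subgroup.index_ker`, `Nat.card_perm`,
`Subgroup.index_map_subtype`, `Subgroup.index_comap_of_surjective`, `Subgroup.comap_map_eq_self`,
`QuotientGroup.mk_out_eq_mul`, `IsLocallyConstant.isOpen_fiber`, `IsOpen.isOpenMap_subtype_val`,
`InfiniteGalois.normal_iff_isGalois`, `IntermediateField.restrictNormalHom_ker`; from the tree:
`fixingSubgroup_fixedField_of_isOpen`, `finiteDimensional_fixedField_of_isOpen`,
`finrank_fixedField_of_isOpen` (`ArtinRestriction`),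
`exists_mem_inertia_absRestrictNormalHom_ne_one` (`ArtinReciprocityCharacterFiniteProofs`),
`inertia_le_ramificationSubgroup`, `toUnramifiedQuot_surjective`, `continuous_toUnramifiedQuot`
(`RestrictedRamification`), Hermite (`NumberFields/HermiteFiniteness`).
-/

noncomputable section

open scoped NumberField Pointwise
open Field IsDedekindDomain Topology

universe u

namespace Literature.NumberTheory.GaloisRepresentations

/-! ### 1. `Φ_p` from the finiteness of the open subgroups of bounded index -/

section Reduction

variable {G : Type*} [Group G] [TopologicalSpace G] [IsTopologicalGroup G] [CompactSpace G]

/-- **`Φ_p` from "finitely many open subgroups of each bounded index".**  Let `G` be a compact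
topological group such that for every `n` the open subgroups of `G` of index `≤ n` are finitely
many.  Then every open subgroup `H ≤ G` admits only finitely many locally constant additive maps
`f : H → ℤ/p` (`MazurPhiP p G`): the kernel of `f` is an open subgroup of `G` of index
`[G:H]·#f(H) ≤ [G:H]·p`, so `f` vanishes on the intersection `N₀` of the finitely many open
subgroups of index `≤ [G:H]·p` — an open subgroup, of finite index by compactness — and `f` is
recovered from the function `q ↦ f(q.out)` on the finite set `G ⧸ N₀`
(`f(h·m) = f(h) + f(m) = f(h)` for `m ∈ N₀`).
This is the formal content of "an open subgroup of finite index has only finitely many continuous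
homomorphisms to `ℤ/p` as soon as it has finitely many open subgroups of index `p`".
[cite: Mazur1989Deforming, §1.1] -/
theorem mazurPhiP_of_finite_setOf_isOpen_index_le (p : ℕ) [Fact p.Prime]
    (hfin : ∀ n : ℕ, {V : Subgroup G | IsOpen (V : Set G) ∧ V.index ≤ n}.Finite) :
    MazurPhiP p G := by
  classical
  intro H hH
  haveI : Finite (G ⧸ H) := Subgroup.quotient_finite_of_isOpen H hH
  haveI : H.FiniteIndex := Subgroup.finiteIndex_of_finite_quotient
  have hp : 0 < p := (Fact.out : p.Prime).pos
  -- the finitely many open subgroups of index `≤ [G:H]·p` and their (open) intersection `N₀`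
  set 𝒱 : Set (Subgroup G) := {V : Subgroup G | IsOpen (V : Set G) ∧ V.index ≤ H.index * p}
    with h𝒱def
  have h𝒱 : 𝒱.Finite := hfin _
  set N₀ : Subgroup G := sInf 𝒱 with hN₀def
  have hN₀open : IsOpen (N₀ : Set G) := by
    rw [hN₀def, Subgroup.coe_sInf]
    exact h𝒱.isOpen_biInter fun V hV => hV.1
  haveI : Finite (G ⧸ N₀) := Subgroup.quotient_finite_of_isOpen N₀ hN₀open
  have hN₀H : N₀ ≤ H := sInf_le ⟨hH, Nat.le_mul_of_pos_right _ hp⟩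
  -- every locally constant additive `f : H → ℤ/p` kills `N₀`
  have hvan : ∀ f : H → ZMod p, IsLocallyConstant f → (∀ x y : H, f (x * y) = f x + f y) →
      ∀ x : H, (x : G) ∈ N₀ → f x = 0 := by
    intro f hlc hadd x hx
    have f1 : f 1 = 0 := by
      have h := hadd 1 1
      rw [mul_one] at h
      exact add_eq_left.mp h.symm
    let φ : H →* Multiplicative (ZMod p) :=
      { toFun := fun x => Multiplicative.ofAdd (f x)
        map_one' := by simp [f1]
        map_mul' := fun x y => by simp [hadd, ofAdd_add] }
    have hφ : ∀ x : H, φ x = Multiplicative.ofAdd (f x) := fun _ => rfl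
    let V : Subgroup G := φ.ker.map H.subtype
    have hVopen : IsOpen (V : Set G) := by
      have hcoe : (V : Set G) = ((↑) : H → G) '' (φ.ker : Set H) := by
        rw [Subgroup.coe_map]
        rfl
      rw [hcoe]
      refine hH.isOpenMap_subtype_val _ ?_
      have hker : (φ.ker : Set H) = {x : H | f x = 0} := by
        ext x
        rw [SetLike.mem_coe, MonoidHom.mem_ker, hφ, Set.mem_setOf_eq, ofAdd_eq_one]
      rw [hker]
      exact hlc.isOpen_fiber 0
    have hVindex : V.index ≤ H.index * p := by
      rw [Subgroup.index_map_subtype, mul_comm]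
      refine Nat.mul_le_mul_left _ ?_
      rw [Subgroup.index_ker]
      have hdvd : Nat.card φ.range ∣ p := by
        have h := Subgroup.card_subgroup_dvd_card φ.range
        rwa [Nat.card_congr Multiplicative.toAdd, Nat.card_zmod] at h
      exact Nat.le_of_dvd hp hdvd
    have hN₀V : N₀ ≤ V := sInf_le ⟨hVopen, hVindex⟩
    obtain ⟨y, hy, hyx⟩ := Subgroup.mem_map.mp (hN₀V hx)
    have hyx' : y = x := Subtype.ext hyx
    subst hyx'
    rw [MonoidHom.mem_ker, hφ, ofAdd_eq_one] at hy
    exact hy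
  -- the injection `f ↦ (q ↦ f(q.out))` into the finite type `G ⧸ N₀ → ℤ/p`
  let F : (H → ZMod p) → (G ⧸ N₀ → ZMod p) := fun f q =>
    if hq : q.out ∈ H then f ⟨q.out, hq⟩ else 0
  have key : ∀ f : H → ZMod p, IsLocallyConstant f → (∀ x y : H, f (x * y) = f x + f y) →
      ∀ h : H, F f (QuotientGroup.mk (h : G)) = f h := by
    intro f hlc hadd h
    obtain ⟨m, hm⟩ := QuotientGroup.mk_out_eq_mul N₀ (h : G)
    have hmH : (m : G) ∈ H := hN₀H m.2
    have hout : (QuotientGroup.mk (h : G) : G ⧸ N₀).out ∈ H := by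
      rw [hm]
      exact H.mul_mem h.2 hmH
    have hF : F f (QuotientGroup.mk (h : G)) = f ⟨_, hout⟩ := by
      simp only [F]
      rw [dif_pos hout]
    have heq : (⟨_, hout⟩ : H) = h * ⟨m, hmH⟩ := Subtype.ext hm
    rw [hF, heq, hadd, hvan f hlc hadd ⟨m, hmH⟩ m.2, add_zero]
  refine Set.Finite.of_finite_image (f := F) (Set.toFinite _) fun f hf f' hf' hff' => ?_
  funext h
  rw [← key f hf.1 hf.2 h, ← key f' hf'.1 hf'.2 h, hff']

end Reduction

/-! ### 2. The bridge: subfields of `K̄` fixed by `N_S` are unramified outside `S` -/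

section Bridge

variable {K : Type u} [Field K] [NumberField K] {S : Set (HeightOneSpectrum (𝓞 K))}

/-- **Subfields of `K_S = K̄^{N_S}` are unramified outside `S`** (Galois case).  Let `L ⊆ K̄` be a
finite Galois extension of `K` whose fixing group `Gal(K̄/L)` contains the ramification subgroup
`N_S` (i.e. `L ⊆ K_S`).  Then every finite place `v ∉ S` of `K` is unramified in `𝓞 L`: otherwise
(`exists_mem_inertia_absRestrictNormalHom_ne_one`: `#I(Q) = e(Q|v) ≠ 1` for some `Q ∣ v` of `𝓞 L`,
and the absolute inertia group `I_𝔓`, `𝔓 ∣ Q`, maps ONTO `I(Q)`, Serre, *Local Fields* I §7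
Prop. 22 (b)) some `g ∈ I_𝔓 ≤ Γ_K` would restrict to `g|_L ≠ 1`; but `I_𝔓 ≤ N_S ≤ Gal(K̄/L)`, so
`g|_L = 1`.  This is the inclusion "`K_S ⊇` every finite Galois `L/K` inside `K̄` on which all the
inertia groups above `v ∉ S` act trivially" of the definition of `G_S`.
[cite: NeukirchSchmidtWingberg2008, VIII §3] [cite: SerreLocalFields1979, Ch. I §7 Prop. 22(b)] -/
theorem isUnramifiedIn_of_ramificationSubgroup_le_fixingSubgroup
    (L : IntermediateField K (AlgebraicClosure K)) [NumberField L] [IsGalois K L]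
    (hL : ramificationSubgroup K S ≤ (L.fixingSubgroup : Subgroup (absoluteGaloisGroup K)))
    {v : HeightOneSpectrum (𝓞 K)} (hv : v ∉ S) :
    Algebra.IsUnramifiedIn (𝓞 L) v.asIdeal := by
  by_contra hram
  obtain ⟨𝔓, h𝔓, g, hg, hne⟩ := exists_mem_inertia_absRestrictNormalHom_ne_one L hram
  have hgL : g ∈ (L.fixingSubgroup : Subgroup (absoluteGaloisGroup K)) :=
    hL (inertia_le_ramificationSubgroup hv h𝔓 hg)
  have hker : absoluteGaloisGroup.toAlgEquiv K g ∈ (AlgEquiv.restrictNormalHom L).ker := by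
    rw [IntermediateField.restrictNormalHom_ker]
    exact hgL
  exact hne (MonoidHom.mem_ker.mp hker)

/-- **Pointwise form, in the vocabulary of Hermite's theorem.**  For `L ⊆ K̄` finite Galois over `K`
with `N_S ≤ Gal(K̄/L)` and a maximal ideal `𝔓` of `𝓞 L` whose contraction to `𝓞 K` is not (the
ideal of) a place in `S`, the extension `𝓞 K → 𝓞 L` is unramified at `𝔓` (Mathlib
`Algebra.IsUnramifiedAt`): `𝔓 ≠ 0` (a ring of integers is not a field), so `𝔭 = 𝔓 ∩ 𝓞 K ≠ 0`
(integrality) is a finite place `v ∉ S`, unramified in `𝓞 L` by the previous theorem.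
[cite: NeukirchSchmidtWingberg2008, VIII §3] -/
theorem isUnramifiedAt_of_ramificationSubgroup_le_fixingSubgroup
    (L : IntermediateField K (AlgebraicClosure K)) [FiniteDimensional K L] [IsGalois K L]
    (hL : ramificationSubgroup K S ≤ (L.fixingSubgroup : Subgroup (absoluteGaloisGroup K)))
    (𝔓 : Ideal (𝓞 L)) [𝔓.IsMaximal]
    (h𝔓 : 𝔓.under (𝓞 K) ∉ (fun v : HeightOneSpectrum (𝓞 K) => v.asIdeal) '' S) :
    Algebra.IsUnramifiedAt (𝓞 K) 𝔓 := by
  haveI : NumberField L := NumberField.of_module_finite K L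
  have h𝔓ne : 𝔓 ≠ ⊥ :=
    Ring.ne_bot_of_isMaximal_of_not_isField ‹_› (NumberField.RingOfIntegers.not_isField L)
  have h𝔭ne : 𝔓.under (𝓞 K) ≠ ⊥ := fun h => h𝔓ne (Ideal.eq_bot_of_comap_eq_bot h)
  let v : HeightOneSpectrum (𝓞 K) := ⟨𝔓.under (𝓞 K), inferInstance, h𝔭ne⟩
  have hv : v ∉ S := fun h => h𝔓 ⟨v, h, rfl⟩
  exact isUnramifiedIn_of_ramificationSubgroup_le_fixingSubgroup L hL hv 𝔓 inferInstance ⟨rfl⟩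

end Bridge

/-! ### 3. Finiteness of the open subgroups of bounded index above `N_S` -/

section Finiteness

variable (K : Type u) [Field K] [NumberField K] {S : Set (HeightOneSpectrum (𝓞 K))}
  (hS : S.Finite)
include hS

/-- **Finitely many open normal subgroups `N_S ≤ N ⊴ Γ_K` of index `≤ n`** (`S` finite): the fixed
field `K̄^N` is a finite GALOIS extension of `K` of degree `[Γ_K : N] ≤ n` (Krull correspondence,
`finrank_fixedField_of_isOpen`), unramified outside `S`
(`isUnramifiedAt_of_ramificationSubgroup_le_fixingSubgroup`), `N ↦ K̄^N` is injective on open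
subgroups (`Gal(K̄/K̄^N) = N`), and the number fields of degree `≤ n` inside `K̄` unramified
outside `S` are finitely many — HERMITE'S THEOREM, in the tree as
`Literature.NumberTheory.NumberFields.finite_of_finrank_le_of_isUnramifiedAt` (Bombieri–Gubler
Cor. B.2.15). [cite: Mazur1989Deforming, §1.2] -/
theorem finite_setOf_isOpen_normal_ramificationSubgroup_le (n : ℕ) :
    {N : Subgroup (absoluteGaloisGroup K) | IsOpen (N : Set (absoluteGaloisGroup K)) ∧ N.Normal ∧
      ramificationSubgroup K S ≤ N ∧ N.index ≤ n}.Finite := by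
  classical
  have hS' : ((fun v : HeightOneSpectrum (𝓞 K) => v.asIdeal) '' S).Finite := hS.image _
  have hH := NumberFields.finite_of_finrank_le_of_isUnramifiedAt K (AlgebraicClosure K) hS' n
  refine Set.Finite.of_finite_image
    (f := fun N : Subgroup (absoluteGaloisGroup K) =>
      (IntermediateField.fixedField N : IntermediateField K (AlgebraicClosure K)))
    ((hH.image Subtype.val).subset ?_) ?_
  · rintro _ ⟨N, ⟨hNo, hNn, hNS, hNi⟩, rfl⟩
    haveI hfd := finiteDimensional_fixedField_of_isOpen N hNo
    have hfix := fixingSubgroup_fixedField_of_isOpen N hNo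
    haveI : IsGalois K
        (IntermediateField.fixedField N : IntermediateField K (AlgebraicClosure K)) := by
      rw [← InfiniteGalois.normal_iff_isGalois, hfix]
      exact hNn
    refine ⟨⟨IntermediateField.fixedField N, hfd⟩, ⟨?_, ?_⟩, rfl⟩
    · change Module.finrank K
        (IntermediateField.fixedField N : IntermediateField K (AlgebraicClosure K)) ≤ n
      rw [finrank_fixedField_of_isOpen N hNo]
      exact hNi
    · intro 𝔓 h𝔓 h𝔓S
      haveI := h𝔓
      exact isUnramifiedAt_of_ramificationSubgroup_le_fixingSubgroup (S := S)
        (IntermediateField.fixedField N) (by rw [hfix]; exact hNS) 𝔓 h𝔓S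
  · intro N hN N' hN' h
    have h' := congrArg IntermediateField.fixingSubgroup h
    simp only at h'
    rwa [fixingSubgroup_fixedField_of_isOpen N hN.1, fixingSubgroup_fixedField_of_isOpen N' hN'.1]
      at h'

/-- **Finitely many open subgroups `N_S ≤ U ≤ Γ_K` of index `≤ n`** (`S` finite).  An open `U` has
finite index (compactness), its normal core `N = ⋂ g U g⁻¹` is open (closed of finite index),
normal, contains the normal subgroup `N_S`, and has index dividing `[Γ_K : U]! ≤ n!` (`Γ_K/N` embeds
in the symmetric group on `Γ_K/U`); so `U` lies in the finite union, over the finitely many such `N`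
(`finite_setOf_isOpen_normal_ramificationSubgroup_le`), of the finite sets `{U' | N ≤ U'}`
(subgroups of the finite group `Γ_K/N`). [cite: Mazur1989Deforming, §1.2] -/
theorem finite_setOf_isOpen_ramificationSubgroup_le (n : ℕ) :
    {U : Subgroup (absoluteGaloisGroup K) | IsOpen (U : Set (absoluteGaloisGroup K)) ∧
      ramificationSubgroup K S ≤ U ∧ U.index ≤ n}.Finite := by
  classical
  have h𝒩 := finite_setOf_isOpen_normal_ramificationSubgroup_le K hS n.factorial
  refine (h𝒩.biUnion (t := fun N => {U : Subgroup (absoluteGaloisGroup K) | N ≤ U})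
    fun N hN => ?_).subset ?_
  · obtain ⟨hNo, hNn, -, -⟩ := hN
    haveI := hNn
    haveI : Finite (absoluteGaloisGroup K ⧸ N) := Subgroup.quotient_finite_of_isOpen N hNo
    refine (Set.finite_range (Subgroup.comap (QuotientGroup.mk' N))).subset fun U hU => ?_
    exact ⟨U.map (QuotientGroup.mk' N),
      Subgroup.comap_map_eq_self (by rw [QuotientGroup.ker_mk']; exact hU)⟩
  · rintro U ⟨hUo, hUS, hUi⟩
    haveI : Finite (absoluteGaloisGroup K ⧸ U) := Subgroup.quotient_finite_of_isOpen U hUo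
    haveI : U.FiniteIndex := Subgroup.finiteIndex_of_finite_quotient
    refine Set.mem_biUnion (x := U.normalCore)
      ⟨?_, inferInstance, Subgroup.normal_le_normalCore.mpr hUS, ?_⟩ U.normalCore_le
    · exact Subgroup.isOpen_of_isClosed_of_finiteIndex _
        (Subgroup.normalCore_isClosed U (U.isClosed_of_isOpen hUo))
    · have hdvd : U.normalCore.index ∣ U.index.factorial := by
        rw [Subgroup.normalCore_eq_ker, Subgroup.index_ker, Subgroup.index_eq_card, ← Nat.card_perm]
        exact Subgroup.card_subgroup_dvd_card (MulAction.toPermHom _ _).range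
      exact (Nat.le_of_dvd (Nat.factorial_pos _) hdvd).trans (Nat.factorial_le hUi)

/-- **Finitely many open subgroups of `G_{K,S}` of index `≤ n`** (`S` finite): pulling back along
the continuous surjection `Γ_K ↠ G_{K,S} = Γ_K ⧸ N_S` is injective on subgroups, preserves the
index, openness, and produces subgroups containing `N_S`. [cite: Mazur1989Deforming, §1.2] -/
theorem finite_setOf_isOpen_index_le_galoisGroupUnramifiedOutside (n : ℕ) :
    {V : Subgroup (GaloisGroupUnramifiedOutside K S) |
      IsOpen (V : Set (GaloisGroupUnramifiedOutside K S)) ∧ V.index ≤ n}.Finite := by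
  refine Set.Finite.of_finite_image (f := Subgroup.comap (toUnramifiedQuot K S))
    ((finite_setOf_isOpen_ramificationSubgroup_le K hS n).subset ?_)
    (Subgroup.comap_injective (toUnramifiedQuot_surjective K S)).injOn
  rintro _ ⟨V, ⟨hVo, hVi⟩, rfl⟩
  refine ⟨hVo.preimage (continuous_toUnramifiedQuot K S), fun σ hσ => ?_, ?_⟩
  · have h1 : toUnramifiedQuot K S σ = 1 := (QuotientGroup.eq_one_iff σ).mpr hσ
    rw [Subgroup.mem_comap, h1]
    exact V.one_mem
  · rw [Subgroup.index_comap_of_surjective _ (toUnramifiedQuot_surjective K S)]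
    exact hVi

end Finiteness

/-! ### 4. The named fact -/

/-- **`Φ_p` holds for `G_{K,S}`** (discharge of the named fact `galoisGroupUnramifiedOutside_phiP`):
for a number field `K`, a FINITE set `S` of finite places and a prime `p`, every open subgroup of
`G_{K,S} = Gal(K_S/K)` has only finitely many continuous homomorphisms to `ℤ/pℤ` — by
`mazurPhiP_of_finite_setOf_isOpen_index_le` (reduction to counting open subgroups of bounded index)
and `finite_setOf_isOpen_index_le_galoisGroupUnramifiedOutside` (Hermite's theorem through the
bridge `isUnramifiedIn_of_ramificationSubgroup_le_fixingSubgroup`).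
[cite: Mazur1989Deforming, §1.2] [cite: Chenevier2014, §3.1 (Example: condition (F) for G_{K,S})] -/
theorem galoisGroupUnramifiedOutside_phiP_holds : galoisGroupUnramifiedOutside_phiP := by
  intro K _ _ S hS p _
  exact mazurPhiP_of_finite_setOf_isOpen_index_le p
    (finite_setOf_isOpen_index_le_galoisGroupUnramifiedOutside K hS)

end Literature.NumberTheory.GaloisRepresentations
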